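import Summits.BirchSwinnertonDyer.BirchSwinnertonDyer.Theorems.PrintCFramBottomClassIndexLawFiveLeBorelKolyvaginPrimeFrobenius
import Summits.BirchSwinnertonDyer.BirchSwinnertonDyer.Theorems.PrintCFramBottomClassIndexLawFiveLeBorelKolyvaginVisibilityLeaf
import Summits.BirchSwinnertonDyer.BirchSwinnertonDyer.Theorems.PrintCFramBottomClassIndexLawFiveLeBorelKernelCebotarev
import Literature.NumberTheory.EllipticCurves.ComplexMultiplicationBurungaleFlachPrimaryProofs
import HarnessLib

/-!
# Route `PrintCFram`, crux C2 `BottomClassIndexLawFiveLe` (stmt-BirchSwinnertonDyer-20372), line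
# `eisenstein-resource-bdp-line` (stub `stub_kolyvaginUpper_borelCM_pairSum_offKrizLi`, input (γ)):
# **KOLYVAGIN PRIMES ARE BLIND TO THE WRONG-SIGN LINE** — a depth-one eigenclass of sign `−η_line`
# is locally trivial at ALL but finitely many Kolyvagin primes, so the descent's Čebotarev axiom
# fails for it
# (cell `bsd-print-cfram`, seat `bsd-line-cfram-p1-w2` g6; helper `--supports` 20372; 0 facts, 0 defs)

HONEST FRAMING. Nothing about BSD is proved here, and nothing of the stub itself; this is a
statement about the MECHANISM proposed for the stub. Kolyvagin's descent at level `p^M`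
(`KolyvaginDescent.HypothesesM`, McCallum 1991 §§4–5) consumes the axiom `cebotarev`: every
non-zero `τ`-eigenclass `c` acquires, at Kolyvagin primes `ℓ` above any bound, a NON-ZERO
localisation (`c ∉ A ℓ`, `A ℓ = ⨅_{v ∋ ℓ} ker loc_v`). With `…BorelKolyvaginPrimeFrobenius`
(the Frobenius of an arbitrary Kolyvagin prime is `∼ g^τ g`; invisible classes die there) and the
finiteness of the exceptional places (bad reduction, `v ∣ n`, ramification of the class — the
tree's `exists_finite_forall_mem_unramifiedKer`), this file proves: for `W/ℚ` with an endomorphism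
`μ` obeying the sign rule of `√−p`, `K` imaginary quadratic, and a `c_*`-eigenclass
`x ∈ H¹(K, W[n])` of sign `ν` whose values lie on `ker μ` while complex conjugation acts on
`ker μ` by `−ν`: **there is a bound `b` such that `x_λ = 0` at the place `λ` of EVERY prime
`ℓ > b` with `ℓ ∤ d_K` and `Frob(ℓ) = Frob(∞)` on `K(W[n])`**
(`exists_bound_forall_mem_torsionLocalKer_of_line_of_lineSign`); in the descent's binders
(`IsKolyvaginPrime N W K p ℓ ∧ FrobEqFrobInfty W K (p^M) ℓ`, `A ℓ` = the strict local kernels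
above `ℓ`) `x ∈ A ℓ` for all Kolyvagin primes `ℓ > b` (`exists_bound_forall_isKolyvaginPrime_mem`),
hence the `cebotarev`-shaped conclusion «`∀ b ∃ ℓ > b` Kolyvagin with `x ∉ A ℓ`» is FALSE for such
`x ≠ 0` (`not_cebotarev_shape_of_line_of_lineSign`). CONVERSELY (§3, with FILE 1's kernel-form
Čebotarev `exists_kolyvaginPrime_gt_pow_kernel_of_eigenTargets`): a `c_*`-eigenclass SEEN by one
`g^τ g` (`[x, g^τ g] ≠ 0`) has `x_λ ≠ 0` at Kolyvagin primes above EVERY bound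
(`exists_kolyvaginPrime_gt_not_mem_torsionLocalKer_of_seen`: take `ρ = g^τ g`, whose value
`(1 + ντ)[x, g]` is `ν`-eigen), so on the Borel CM class (`…VisibilityLeaf`) every non-zero
eigenclass with a value off `W[𝔭]`, or on `W[𝔭]` with `η_line = ν`, satisfies the `cebotarev`
shape (`…_of_offLine`, `…_of_line_of_lineSign_eq`): the DICHOTOMY «blind for all large `ℓ`» /
«seen above every bound» is exactly «depth one ∧ sign `−η_line`» / its negation. On the Borel CM
class the blind `x` are the images of `H¹(ℚ, 𝔽_p(χ_odd))` for the odd line character. THEOREMS ONLY; no definition, no named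
fact, no `sorry`. BSD is not proved by any of this; no summit statement is proved by this seat.
References: [McCallumLMS1991] §3 (3), §4 (`S₁(M)`), §5; [GrossLMS1991] §3, Prop. 9.6.
-/

set_option autoImplicit false
-- `…BirchSwinnertonDyer.BirchSwinnertonDyer.Theorems…` is the problem's mandated namespace (D-0017).
set_option linter.dupNamespace false

noncomputable section

open scoped Classical

namespace Summit.BirchSwinnertonDyer.BirchSwinnertonDyer.Theorems.PrintCFram.BorelKolyvaginPairing

open WeierstrassCurve NumberField IsDedekindDomain Field Literature.NumberTheory.EllipticCurves
  Literature.NumberTheory.GaloisRepresentations Literature.NumberTheory.EllipticCurves.Rank1Residual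
  Summit.BirchSwinnertonDyer.BirchSwinnertonDyer.Theorems.PrintCFram.BorelHomothety

/-! ## §1 A bound past which every prime lies under only good, unramified, prime-to-`n` places -/

section Bound

variable {K : Type} [Field K] [NumberField K]

/-- **Finitely many places contain a non-zero integer.** [folklore] -/
theorem finite_setOf_intCast_mem {n : ℤ} (hn : n ≠ 0) :
    {w : HeightOneSpectrum (𝓞 K) | ((n : 𝓞 K)) ∈ w.asIdeal}.Finite := by
  have hI : (Ideal.span {(n : 𝓞 K)} : Ideal (𝓞 K)) ≠ 0 := by
    rw [Ne, Ideal.zero_eq_bot, Ideal.span_singleton_eq_bot]; exact_mod_cast hn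
  refine (Ideal.finite_factors hI).subset fun w hw ↦ ?_
  rw [Set.mem_setOf_eq, Ideal.dvd_span_singleton]
  exact hw

/-- **A bound past which a rational prime lies under no place of a given finite set.** For a
finite set `S` of finite places of `K` there is `b` such that every prime `ℓ > b` is contained in no
`w ∈ S` (each `w` contains exactly one rational prime, tree `exists_natPrime_mem`). [folklore] -/
theorem exists_bound_forall_not_mem {S : Set (HeightOneSpectrum (𝓞 K))} (hS : S.Finite) :
    ∃ b : ℕ, ∀ ℓ : ℕ, b < ℓ → ℓ.Prime → ∀ w ∈ S, (ℓ : 𝓞 K) ∉ w.asIdeal := by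
  choose f hf hfw using fun w : HeightOneSpectrum (𝓞 K) ↦ exists_natPrime_mem w
  refine ⟨hS.toFinset.sup f, fun ℓ hbℓ hℓ w hw hℓw ↦ ?_⟩
  have hle : f w ≤ hS.toFinset.sup f := Finset.le_sup (hS.mem_toFinset.mpr hw)
  have hne : f w ≠ ℓ := by omega
  exact not_natCast_mem_of_prime_ne (hf w) hℓ hne w (hfw w) hℓw

end Bound

/-! ## §2 Kolyvagin primes are blind to depth-one classes of sign `−η_line` -/

section Blind

variable (W : WeierstrassCurve ℚ) [W.IsElliptic] (p : ℕ) [hp : Fact p.Prime]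
variable {K : Type} [Field K] [NumberField K]

omit hp in
/-- **KOLYVAGIN PRIMES ARE BLIND TO THE WRONG-SIGN LINE.** `W/ℚ` elliptic with `μ ∈ End W(ℚ̄)`
obeying the sign rule of `√−p`; `K` imaginary quadratic with complex conjugation `c`; `n ≠ 0` a
natural level; `x ∈ H¹(K, W[n])` a `c_*`-eigenclass of sign `ν = ±1` all of whose values
`[x, g]` (`g ∈ Γ_{K(W[n])}`) lie on `ker μ`, and some complex conjugation acting on `ker μ` by `−ν`.
Then **there is `b` such that for every prime `ℓ > b` with `ℓ ∤ d_K` and `Frob(ℓ) = Frob(∞)` on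
`K(W[n])`, `x_w = 0` in `H¹(K_w, W[n])` at every place `w ∋ ℓ`** (the place is unique). The bound
excludes the places of bad reduction, those dividing `n`, and those where `x` ramifies (all finite).
[cite: McCallumLMS1991, §3 (3) and §4] [cite: GrossLMS1991, Prop. 9.6] -/
theorem exists_bound_forall_mem_torsionLocalKer_of_line_of_lineSign (hK : IsImaginaryQuadratic K)
    {c : K ≃ₐ[ℚ] K} (hc : c ≠ 1) {s : AlgebraicClosure ℚ} {μ : AddMonoid.End W.geomPoints}
    (hs : s ^ 2 = ((-(p : ℤ) : ℤ) : AlgebraicClosure ℚ))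
    (hcomm : ∀ g : absoluteGaloisGroup ℚ, g • s = s → ∀ P, μ (g • P) = g • μ P)
    (hanti : ∀ g : absoluteGaloisGroup ℚ, g • s = -s → ∀ P, μ (g • P) = -(g • μ P))
    {n : ℕ} (hn0 : n ≠ 0) {x : galH1Torsion (W.baseChange K) (n : ℤ)} {ν : ℤ}
    (hν : ν = 1 ∨ ν = -1) (hx : conjAct W c (n : ℤ) x = ν • x)
    (hline : ∀ g ∈ torsionFixing (W.baseChange K) (n : ℤ),
      μ ((RatClosure.torsionEquiv (K := K) W (n : ℤ)).symm (h1Eval (W.baseChange K) (n : ℤ) x g) :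
        W.geomTorsion (n : ℤ)) = 0)
    {c₁ : absoluteGaloisGroup ℚ} (hc₁ : IsComplexConjugation (Rat.castHom ℝ) c₁)
    (hη : ∀ P : W.geomPoints, μ P = 0 → c₁ • P = -(ν • P)) :
    ∃ b : ℕ, ∀ ℓ : ℕ, b < ℓ → ℓ.Prime → ¬ ((ℓ : ℤ) ∣ NumberField.discr K) →
      FrobEqFrobInfty W K n ℓ → ∀ w : HeightOneSpectrum (𝓞 K), (ℓ : 𝓞 K) ∈ w.asIdeal →
        x ∈ (W.baseChange K).torsionLocalKer (w.adicCompletion K) (n : ℤ) := by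
  have hn : ((n : ℕ) : ℤ) ≠ 0 := by exact_mod_cast hn0
  -- the three exceptional sets
  obtain ⟨T, hTfin, hT⟩ := exists_finite_forall_mem_unramifiedKer (W.baseChange K) hn x
  have hB : ((W.baseChange K).badPlaces (𝓞 K)).Finite := (W.baseChange K).finite_badPlaces_holds (𝓞 K)
  have hD : {w : HeightOneSpectrum (𝓞 K) | (((n : ℤ) : 𝓞 K)) ∈ w.asIdeal}.Finite :=
    finite_setOf_intCast_mem hn
  obtain ⟨b, hb⟩ := exists_bound_forall_not_mem ((hTfin.union hB).union hD)
  refine ⟨b, fun ℓ hbℓ hℓ hℓD hfrob w hw ↦ ?_⟩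
  have hwS := hb ℓ hbℓ hℓ w
  have hwT : w ∉ T := fun h ↦ hwS (Or.inl (Or.inl h)) hw
  have hwB : w ∉ (W.baseChange K).badPlaces (𝓞 K) := fun h ↦ hwS (Or.inl (Or.inr h)) hw
  have hwn : (((n : ℤ) : 𝓞 K)) ∉ w.asIdeal := fun h ↦ hwS (Or.inr h) hw
  exact mem_torsionLocalKer_place_of_line_of_lineSign W p hK hc hs hcomm hanti hn0 hν hx hline hc₁ hη
    hℓ hℓD hfrob hw hwB hwn (hT w hwT)

/-- **In the descent's binders.** Same, for the Kolyvagin primes of `(E, K, p)` at level `N`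
(`IsKolyvaginPrime N W K p ℓ`: `ℓ` prime, `ℓ ∤ N d_K p`, `(ℓ)` prime, `Frob(ℓ) = Frob(∞)` on `K(E_p)`)
with `Frob(ℓ) = Frob(∞)` on `K(E_{p^M})`: past a bound, `x` lies in the strict local kernel at the
place `λ` of EVERY such `ℓ` — `x ∈ A ℓ` in `KolyvaginDescent.HypothesesM`'s notation.
[cite: McCallumLMS1991, §4 (`S₁(M)`) and §3 (3)] -/
theorem exists_bound_forall_isKolyvaginPrime_mem_torsionLocalKer (hK : IsImaginaryQuadratic K)
    {c : K ≃ₐ[ℚ] K} (hc : c ≠ 1) {s : AlgebraicClosure ℚ} {μ : AddMonoid.End W.geomPoints}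
    (hs : s ^ 2 = ((-(p : ℤ) : ℤ) : AlgebraicClosure ℚ))
    (hcomm : ∀ g : absoluteGaloisGroup ℚ, g • s = s → ∀ P, μ (g • P) = g • μ P)
    (hanti : ∀ g : absoluteGaloisGroup ℚ, g • s = -s → ∀ P, μ (g • P) = -(g • μ P))
    {N M : ℕ} {x : galH1Torsion (W.baseChange K) ((p ^ M : ℕ) : ℤ)} {ν : ℤ}
    (hν : ν = 1 ∨ ν = -1) (hx : conjAct W c ((p ^ M : ℕ) : ℤ) x = ν • x)
    (hline : ∀ g ∈ torsionFixing (W.baseChange K) ((p ^ M : ℕ) : ℤ),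
      μ ((RatClosure.torsionEquiv (K := K) W ((p ^ M : ℕ) : ℤ)).symm
        (h1Eval (W.baseChange K) ((p ^ M : ℕ) : ℤ) x g) : W.geomTorsion ((p ^ M : ℕ) : ℤ)) = 0)
    {c₁ : absoluteGaloisGroup ℚ} (hc₁ : IsComplexConjugation (Rat.castHom ℝ) c₁)
    (hη : ∀ P : W.geomPoints, μ P = 0 → c₁ • P = -(ν • P)) :
    ∃ b : ℕ, ∀ ℓ : ℕ, b < ℓ → IsKolyvaginPrime N W K p ℓ → FrobEqFrobInfty W K (p ^ M) ℓ →
      ∀ w : HeightOneSpectrum (𝓞 K), (ℓ : 𝓞 K) ∈ w.asIdeal →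
        x ∈ (W.baseChange K).torsionLocalKer (w.adicCompletion K) ((p ^ M : ℕ) : ℤ) := by
  obtain ⟨b, hb⟩ := exists_bound_forall_mem_torsionLocalKer_of_line_of_lineSign W p hK hc hs hcomm
    hanti (pow_ne_zero M hp.out.ne_zero) hν hx hline hc₁ hη
  exact ⟨b, fun ℓ hbℓ hKol hfrob w hw ↦ hb ℓ hbℓ hKol.1 hKol.2.2.1 hfrob w hw⟩

/-- **The descent's Čebotarev axiom fails for such a class.** The `cebotarev`-shaped conclusion
«above every bound there is a Kolyvagin prime `ℓ` of level `p^M` at whose place `x_λ ≠ 0`»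
(McCallum Cor. 3.2 with `N = 1` for the single class `x`) is FALSE for a depth-one eigenclass of
sign `−η_line` — whatever `x ≠ 0` is. [cite: McCallumLMS1991, §3 Cor. 3.2] -/
theorem not_cebotarev_shape_of_line_of_lineSign (hK : IsImaginaryQuadratic K)
    {c : K ≃ₐ[ℚ] K} (hc : c ≠ 1) {s : AlgebraicClosure ℚ} {μ : AddMonoid.End W.geomPoints}
    (hs : s ^ 2 = ((-(p : ℤ) : ℤ) : AlgebraicClosure ℚ))
    (hcomm : ∀ g : absoluteGaloisGroup ℚ, g • s = s → ∀ P, μ (g • P) = g • μ P)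
    (hanti : ∀ g : absoluteGaloisGroup ℚ, g • s = -s → ∀ P, μ (g • P) = -(g • μ P))
    {N M : ℕ} {x : galH1Torsion (W.baseChange K) ((p ^ M : ℕ) : ℤ)} {ν : ℤ}
    (hν : ν = 1 ∨ ν = -1) (hx : conjAct W c ((p ^ M : ℕ) : ℤ) x = ν • x)
    (hline : ∀ g ∈ torsionFixing (W.baseChange K) ((p ^ M : ℕ) : ℤ),
      μ ((RatClosure.torsionEquiv (K := K) W ((p ^ M : ℕ) : ℤ)).symm
        (h1Eval (W.baseChange K) ((p ^ M : ℕ) : ℤ) x g) : W.geomTorsion ((p ^ M : ℕ) : ℤ)) = 0)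
    {c₁ : absoluteGaloisGroup ℚ} (hc₁ : IsComplexConjugation (Rat.castHom ℝ) c₁)
    (hη : ∀ P : W.geomPoints, μ P = 0 → c₁ • P = -(ν • P)) :
    ¬ ∀ b : ℕ, ∃ ℓ : ℕ, b < ℓ ∧ IsKolyvaginPrime N W K p ℓ ∧ FrobEqFrobInfty W K (p ^ M) ℓ ∧
        ∃ w : HeightOneSpectrum (𝓞 K), (ℓ : 𝓞 K) ∈ w.asIdeal ∧
          x ∉ (W.baseChange K).torsionLocalKer (w.adicCompletion K) ((p ^ M : ℕ) : ℤ) := by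
  intro h
  obtain ⟨b, hb⟩ := exists_bound_forall_isKolyvaginPrime_mem_torsionLocalKer W p hK hc hs hcomm
    hanti (N := N) hν hx hline hc₁ hη
  obtain ⟨ℓ, hbℓ, hKol, hfrob, w, hw, hxw⟩ := h b
  exact hxw (hb ℓ hbℓ hKol hfrob w hw)

end Blind

/-! ## §3 Conversely: a class seen by one `g^τ g` is seen by Kolyvagin primes above every bound -/

section Seen

variable {W : WeierstrassCurve ℚ} {K : Type} [Field K] [NumberField K]

/-- **SEEN classes are seen above every bound (any `E/ℚ`, image-free).** `K` imaginary quadratic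
with complex conjugation `c` lifted along `c₀`; `p` odd; `x ∈ H¹(K, E[p^M])` a `c_*`-eigenclass of
sign `ν = ±1` with `[x, g^τ g] ≠ 0` for SOME `g ∈ Γ_{K(E[p^M])}`. Then above every `b` there is a
Kolyvagin prime `ℓ` of level `p^M` (`ℓ ∤ N d_K p`, `(ℓ)` prime, `Frob(ℓ) = Frob(∞)` on `K(E_{p^M})`)
with **`x_λ ≠ 0`**. Proof: `ρ = g^τ g` has the `ν`-eigen value `(1 + ντ)[x, g] ≠ 0`; FILE 1's
kernel-form Čebotarev for the single class `x`. [cite: McCallumLMS1991, §3 Prop. 3.1 with (2), (3)] -/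
theorem exists_kolyvaginPrime_gt_not_mem_torsionLocalKer_of_seen
    (hC : Literature.NumberTheory.Automorphic.chebotarev_artinRep) {N : ℕ} [NeZero N]
    [W.IsElliptic] (hK : IsImaginaryQuadratic K) {p : ℕ} (hp : p.Prime) (hp2 : p ≠ 2) {M : ℕ}
    {c : K ≃ₐ[ℚ] K} {c₀ : absoluteGaloisGroup ℚ} (hc₀ : IsComplexConjugation (Rat.castHom ℝ) c₀)
    (ht : IsLiftOfAut c (absGaloisTransport (K := ℚ) (L := K) c₀).toRingEquiv)
    {x : galH1Torsion (W.baseChange K) ((p ^ M : ℕ) : ℤ)} {ν : ℤ} (hν : ν = 1 ∨ ν = -1)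
    (hx : conjAct W c ((p ^ M : ℕ) : ℤ) x = ν • x) {g : absoluteGaloisGroup K}
    (hg : g ∈ torsionFixing (W.baseChange K) ((p ^ M : ℕ) : ℤ))
    (hseen : h1Eval (W.baseChange K) ((p ^ M : ℕ) : ℤ) x (ht.conjGalCMH g * g) ≠ 0) (b : ℕ) :
    ∃ ℓ : ℕ, b < ℓ ∧ ℓ.Prime ∧ ¬ ℓ ∣ N ∧ ¬ ((ℓ : ℤ) ∣ NumberField.discr K) ∧ ℓ ≠ p ∧
      (Ideal.span {(ℓ : 𝓞 K)}).IsPrime ∧ FrobEqFrobInfty W K (p ^ M) ℓ ∧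
      ∀ v : HeightOneSpectrum (𝓞 K), (ℓ : 𝓞 K) ∈ v.asIdeal →
        x ∉ (W.baseChange K).torsionLocalKer (v.adicCompletion K) ((p ^ M : ℕ) : ℤ) := by
  have hinv : ∀ y, (absGaloisTransport (K := ℚ) (L := K) c₀).toRingEquiv
      ((absGaloisTransport (K := ℚ) (L := K) c₀).toRingEquiv y) = y := fun y ↦
    RatClosure.absGaloisTransport_absGaloisTransport_of_sq_eq_one hc₀.sq_eq_one y
  have hρ : ht.conjGalCMH g * g ∈ torsionFixing (W.baseChange K) ((p ^ M : ℕ) : ℤ) :=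
    mul_mem (ht.conjGalCMH_mem_torsionFixing W hinv _ hg) hg
  -- the value at `ρ = g^τ g` is `ν`-eigen
  have hval : ht.torsionMap W ((p ^ M : ℕ) : ℤ)
      (h1Eval (W.baseChange K) ((p ^ M : ℕ) : ℤ) x (ht.conjGalCMH g * g)) =
      ν • h1Eval (W.baseChange K) ((p ^ M : ℕ) : ℤ) x (ht.conjGalCMH g * g) := by
    have hνν : ν * ν = 1 := by rcases hν with rfl | rfl <;> norm_num
    rw [h1Eval_conjGalCMH_mul_eq_add_of_eigen W ht hinv _ hν hx hg, map_add, map_zsmul,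
      ht.torsionMap_torsionMap W hinv, smul_add, smul_smul, hνν, one_smul, add_comm]
  obtain ⟨ℓ, hbℓ, hℓ, hℓN, hℓD, hℓp, hprime, hfrob, hloc⟩ :=
    exists_kolyvaginPrime_gt_pow_kernel_of_eigenTargets (N := N) hC hK hp hp2 hc₀ ht hinv
      (fun _ : Unit ↦ x) (ν := fun _ ↦ ν) (fun _ ↦ hx) hρ (fun _ ↦ hval) b
  refine ⟨ℓ, hbℓ, hℓ, hℓN, hℓD, hℓp, hprime, hfrob, fun v hv hxv ↦ hseen ?_⟩
  exact (hloc x (AddSubgroup.subset_closure (Set.mem_range_self ())) v hv).mp hxv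

variable (W) (p : ℕ) [hp : Fact p.Prime]
variable {σ : K ≃ₐ[ℚ] K} {c₀ : absoluteGaloisGroup ℚ}

/-- **On the class: a value off the line ⟹ seen above every bound.** [cite: McCallumLMS1991, §3 Prop. 3.1] -/
theorem exists_kolyvaginPrime_gt_not_mem_torsionLocalKer_of_offLine
    (hC : Literature.NumberTheory.Automorphic.chebotarev_artinRep) {N : ℕ} [NeZero N] [W.IsElliptic]
    (hCM : W.HasCM) (h5 : 5 ≤ p) (hram : CMRamified W p)
    {s : AlgebraicClosure ℚ} {μ : AddMonoid.End W.geomPoints} {m : ℤ}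
    (hs : s ^ 2 = ((-(p : ℤ) : ℤ) : AlgebraicClosure ℚ)) (hm : m.natAbs = p)
    (hμμ : ∀ P, μ (μ P) = m • P)
    (hcomm : ∀ g : absoluteGaloisGroup ℚ, g • s = s → ∀ P, μ (g • P) = g • μ P)
    (hanti : ∀ g : absoluteGaloisGroup ℚ, g • s = -s → ∀ P, μ (g • P) = -(g • μ P))
    (hK : IsImaginaryQuadratic K) (hc₀ : IsComplexConjugation (Rat.castHom ℝ) c₀)
    (ht : IsLiftOfAut σ (absGaloisTransport (K := ℚ) (L := K) c₀).toRingEquiv) {M : ℕ} (hM : 1 ≤ M)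
    {x : galH1Torsion (W.baseChange K) ((p ^ M : ℕ) : ℤ)} {ν : ℤ} (hν : ν = 1 ∨ ν = -1)
    (hx : conjAct W σ ((p ^ M : ℕ) : ℤ) x = ν • x) {g₀ : absoluteGaloisGroup K}
    (hg₀ : g₀ ∈ torsionFixing (W.baseChange K) ((p ^ M : ℕ) : ℤ))
    (hoff : μ ((RatClosure.torsionEquiv (K := K) W ((p ^ M : ℕ) : ℤ)).symm
      (h1Eval (W.baseChange K) ((p ^ M : ℕ) : ℤ) x g₀) : W.geomTorsion ((p ^ M : ℕ) : ℤ)) ≠ 0)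
    (b : ℕ) :
    ∃ ℓ : ℕ, b < ℓ ∧ ℓ.Prime ∧ ¬ ℓ ∣ N ∧ ¬ ((ℓ : ℤ) ∣ NumberField.discr K) ∧ ℓ ≠ p ∧
      (Ideal.span {(ℓ : 𝓞 K)}).IsPrime ∧ FrobEqFrobInfty W K (p ^ M) ℓ ∧
      ∀ v : HeightOneSpectrum (𝓞 K), (ℓ : 𝓞 K) ∈ v.asIdeal →
        x ∉ (W.baseChange K).torsionLocalKer (v.adicCompletion K) ((p ^ M : ℕ) : ℤ) := by
  have hpr : p.Prime := hp.out
  have hinv : ∀ y, (absGaloisTransport (K := ℚ) (L := K) c₀).toRingEquiv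
      ((absGaloisTransport (K := ℚ) (L := K) c₀).toRingEquiv y) = y := fun y ↦
    RatClosure.absGaloisTransport_absGaloisTransport_of_sq_eq_one hc₀.sq_eq_one y
  have hKp : Module.finrank ℚ K < p := by rw [hK.1]; omega
  obtain ⟨g, hg, hne⟩ := exists_h1Eval_conjGalCMH_mul_ne_zero_of_offLine W p hCM h5 hram hs hm hμμ
    hcomm hanti hKp ht (fun _ ↦ rfl) hinv hc₀ hM hν hx hg₀ hoff
  exact exists_kolyvaginPrime_gt_not_mem_torsionLocalKer_of_seen (N := N) hC hK hpr (by omega) hc₀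
    ht hν hx hg hne b

/-- **On the class: depth one with `η_line = ν`, `x ≠ 0` ⟹ seen above every bound.** With FILE 3's
criterion this makes the dichotomy exact: a non-zero eigenclass is blind to all large Kolyvagin
primes iff it has depth one and sign `−η_line`; otherwise it is seen above every bound.
[cite: McCallumLMS1991, §3 Prop. 3.1] -/
theorem exists_kolyvaginPrime_gt_not_mem_torsionLocalKer_of_line_of_lineSign_eq
    (hC : Literature.NumberTheory.Automorphic.chebotarev_artinRep) {N : ℕ} [NeZero N] [W.IsElliptic]
    (hCM : W.HasCM) (h5 : 5 ≤ p) (hram : CMRamified W p) {μ : AddMonoid.End W.geomPoints}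
    (hK : IsImaginaryQuadratic K) (hc₀ : IsComplexConjugation (Rat.castHom ℝ) c₀)
    (ht : IsLiftOfAut σ (absGaloisTransport (K := ℚ) (L := K) c₀).toRingEquiv) {M : ℕ} (hM : 1 ≤ M)
    {x : galH1Torsion (W.baseChange K) ((p ^ M : ℕ) : ℤ)} (hx0 : x ≠ 0) {ν : ℤ}
    (hν : ν = 1 ∨ ν = -1) (hx : conjAct W σ ((p ^ M : ℕ) : ℤ) x = ν • x)
    (hline : ∀ g ∈ torsionFixing (W.baseChange K) ((p ^ M : ℕ) : ℤ),
      μ ((RatClosure.torsionEquiv (K := K) W ((p ^ M : ℕ) : ℤ)).symm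
        (h1Eval (W.baseChange K) ((p ^ M : ℕ) : ℤ) x g) : W.geomTorsion ((p ^ M : ℕ) : ℤ)) = 0)
    (hη : ∀ P : W.geomPoints, μ P = 0 → c₀ • P = ν • P) (b : ℕ) :
    ∃ ℓ : ℕ, b < ℓ ∧ ℓ.Prime ∧ ¬ ℓ ∣ N ∧ ¬ ((ℓ : ℤ) ∣ NumberField.discr K) ∧ ℓ ≠ p ∧
      (Ideal.span {(ℓ : 𝓞 K)}).IsPrime ∧ FrobEqFrobInfty W K (p ^ M) ℓ ∧
      ∀ v : HeightOneSpectrum (𝓞 K), (ℓ : 𝓞 K) ∈ v.asIdeal →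
        x ∉ (W.baseChange K).torsionLocalKer (v.adicCompletion K) ((p ^ M : ℕ) : ℤ) := by
  have hpr : p.Prime := hp.out
  have hinv : ∀ y, (absGaloisTransport (K := ℚ) (L := K) c₀).toRingEquiv
      ((absGaloisTransport (K := ℚ) (L := K) c₀).toRingEquiv y) = y := fun y ↦
    RatClosure.absGaloisTransport_absGaloisTransport_of_sq_eq_one hc₀.sq_eq_one y
  obtain ⟨g, hg, hne⟩ := exists_h1Eval_conjGalCMH_mul_ne_zero_of_line_of_lineSign_eq W p hCM h5
    hram hK.1 ht (fun _ ↦ rfl) hinv hM hx0 hν hx hline hη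
  exact exists_kolyvaginPrime_gt_not_mem_torsionLocalKer_of_seen (N := N) hC hK hpr (by omega) hc₀
    ht hν hx hg hne b

end Seen

end Summit.BirchSwinnertonDyer.BirchSwinnertonDyer.Theorems.PrintCFram.BorelKolyvaginPairing

end
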